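/-
Origin: expansion seat `planner-pub-hodgecm-pv02-g6-0`, handover #4 2026-08-18T10:04:34Z (`HOME/pub-hodgecm-pv02-g6/lean/Pv02g6/ArchAWeilGenuineWitness.lean`, md5 0ffe61af, 291 lines);
landed by the gen-7 packager in gate run 28 as `HodgeCM/PerL34/ArchAWeilGenuineWitness.lean` (import ^import Pv[0-9]+g[0-9]+\.→import HodgeCM.PerL34. ×3).
-/
/-
Origin: HOME/pub-hodgecm-pv02-g6/lean/Pv02g6/ArchAWeilGenuineWitness.lean (module `Pv02g6.ArchAWeilGenuineWitness`; the
packager renames to `HodgeCM.PerL34.ArchAWeilGenuineWitness` and rewrites `import Pv02g6.X` ↦ `import HodgeCM.PerL34.X`,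
`import Pv02g5.ArchAWeilSchrodinger` ↦ `import HodgeCM.PerL34.ArchAWeilSchrodinger`)
— session planner-pub-hodgecm-pv02-g6-0 (unit pub-hodgecm-pv02-g6, DAG-NODE PROVER #02 gen 6).
DAG node (HOME/LEMMAS.md v15 §1): N27 = PerL v5 Lemma 4.1(a) `lem:arch` (tex ll. 480–482, pf 493–496; set-up
ll. 262–266) — NON-VACUITY of the genuine-torus pipeline of this seat's #1–#3.
Imports: this seat's `ArchAWeilGenuine` (#2) and `ArchAWeilKFiniteCriterion` (#3), pv02-g5's `ArchAWeilSchrodinger`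
(#3 c2efa8863a51) — all three in the RUN 27 frozen set.
-/
import Summits.HodgeConjecture.HodgeCM.PerL34.ArchAWeilGenuine
import Summits.HodgeConjecture.HodgeCM.PerL34.ArchAWeilKFiniteCriterion
import Summits.HodgeConjecture.HodgeCM.PerL34.ArchAWeilSchrodinger

/-!
# N27 over the genuine torus is NOT vacuous: a constructed Weil theta model over `U(1)_{L/L⁺}(𝔸_{L⁺})`

`ArchAWeilGenuine.N27_genuine` (#2) proves pv02's verbatim rendering `N27_statement` of PerL v5 Lemma 4.1(a) for the
`K`-finite index space of ANY Weil theta model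
`M : WeilThetaModel GU ΓU (relNormOneIdeles L⁺ L) (relNormOneRat L⁺ L)` over PerL's genuine torus
`U(W_i)(𝔸) = U(1)_{L/L⁺}(𝔸_{L⁺})` (pv11 lineage).  The obvious referee question is whether that binder type is
inhabited by anything with non-zero theta kernels.  This file answers it IN THE KERNEL, with nothing cited and
nothing posited:

## §1  Pull-back of a Weil theta model along the second group (generic, reusable)

`WeilThetaModel.comapRight M f hf hΓ`: for `M : WeilThetaModel GU ΓU G' Γ'`, a continuous homomorphism
`f : G →* G'` with `f(Γ) ⊆ Γ'` gives a Weil theta model over `(GU, ΓU, G, Γ)` with the SAME Weil datum [We64]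
(`Mp(X)_A`, `S(X_A)`, action, `r_k(Ps_k)`, `Θ`, n° 39, Théorème 6), the same index space `𝒮^κ`, and the splitting
`s ∘ (id × f)`.  Its kernels are the old ones read through `f` (`θ_comapRight_mk`, `rfl`), its Weil action is
`ω'(h) = ω(f h)` (`coe_omg_comapRight`, `rfl`), and a weight law `θ_{ω(f h)Φ} = c • θ_Φ` upstairs transfers to
`θ_{ω'(h)Φ} = c • θ_Φ` downstairs (`θ_omg_comapRight_of_weight`).  (Whoever restricts or pulls back the adelic model
of PerL § 3.2 — GAPS carverg2-X1 — along a homomorphism of the `U(W)`-side can use this verbatim.)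

## §2  The Schrödinger–lattice model pulled back along an automorphic character of the genuine torus

For a CM field `L`, an automorphic character `χ` of `[U(W)] = U(W)(𝔸)/U(W)(L⁺)` (pv11's
`PontryaginDual (relNormOneIdeles L⁺ L ⧸ relNormOneRat L⁺ L)`) lifts to the continuous homomorphism
`charIdeles L χ = χ ∘ cl : U(W)(𝔸) →* S¹`, trivial on the rational points.  Pulling pv14-g4's CONSTRUCTED
Schrödinger–lattice model `SchwartzWeil.schrodingerModel E Λ m Γ hΓ` (second group `S¹`) back along it gives

  `genuineSchrodingerModel E Λ m Γ hΓ L χ :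
      WeilThetaModel (Multiplicative E) (latticeSubgroup E Λ) (relNormOneIdeles L⁺ L) (relNormOneRat L⁺ L)`,

a Weil theta model over the GENUINE torus, with:
* `θ_genuineSchrodinger_ne_zero` — some theta kernel is non-zero (pv14-g4 `schrodingerModel_θ_ne_zero`);
* `θ_omg_realPlaceCircle_genuineSchrodinger` — if `χ` has real-place exponents `e` (pv11-g5:
  `χ (realPlaceCircleQuot L b u) = u ^ (e b)`; such `χ` exist for EVERY `e`, `exists_char_forall_realPlaceCircle'`),
  the real-place circle `ι_b = realPlaceCircle L b` acts on every kernel by the single weight `e b * m`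
  (pv02-g5 #3 `θ_omg_schrodinger` transferred by §1);
* hence `KernelWeightDecomposition` (`kernelWeightDecomposition_genuineSchrodinger`), hence — by this seat's #3 —
  `OrbitFinite` and `kFinite = the model itself` (`orbitFinite_genuineSchrodinger`, `finiteSK_genuineSchrodinger`),
  hence — by this seat's #2 — **`N27_genuineSchrodinger : (lineData (genuineSchrodingerModel …) ι₁ (realPlaceCircle L)
  kJ).N27_statement` with NO hypothesis**, and `exists_genuine_model_N27`: for every CM field `L` and every exponent
  vector `e` the binder type of `N27_genuine` is inhabited by a constructed model with a non-zero kernel, all of whose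
  kernels have real-place weights `e b * m`, and for which N27 holds.

So pv14-g4 (Schrödinger model) + pv02-g5 #3 (its weights) + pv11-g5 (genuine torus, real-place circles, characters
of prescribed type) + pv02-g6 #1–#3 compose end-to-end with every hypothesis discharged.

AUDIT NOTE.  This is NOT PerL's model: PerL's `𝒮^κ` lives on the Weil representation of the dual pair
`U(V♯) × U(W_i)` (tex ll. 259–268), whose construction is GAPS carverg2-X1 (pv09-g5 `GenuineThetaInput`, prl1
`AdelicUnitaryModel`).  The present model only certifies that the TYPED INTERFACE those seats must instantiate —
`WeilThetaModel _ _ (relNormOneIdeles L⁺ L) (relNormOneRat L⁺ L)` + the N27 pipeline over it — is consistent and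
non-degenerate.  Label (LEMMAS v3 (c)): KERNEL; nothing cited, nothing posited; vacuity: see `exists_genuine_model_N27`.
-/

noncomputable section

open Topology

namespace HodgeCM

/-! ## §1  Pull-back of a Weil theta model along a homomorphism of the second group -/

namespace WeilThetaModel

variable {GU : Type} [Group GU] [TopologicalSpace GU] {ΓU : Subgroup GU}
variable {G : Type} [Group G] [TopologicalSpace G] {Γ : Subgroup G}
variable {G' : Type} [Group G'] [TopologicalSpace G'] {Γ' : Subgroup G'}

/-- **Pull-back of a Weil theta model along the second group.**  Same Weil datum, same `𝒮^κ`; the dual-pair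
splitting becomes `s ∘ (id × f)`; rationality of `s` on `ΓU × Γ` follows from `f(Γ) ⊆ Γ'`. -/
def comapRight (M : WeilThetaModel GU ΓU G' Γ') (f : G →* G') (hf : Continuous f) (hΓ : ∀ γ ∈ Γ, f γ ∈ Γ') :
    WeilThetaModel GU ΓU G Γ where
  W := M.W
  act_one := M.act_one
  theta_act := M.theta_act
  actionContinuous := M.actionContinuous
  thetaContinuousInvariant := M.thetaContinuousInvariant
  dist_cont := M.dist_cont
  s := M.s.comp ((MonoidHom.id GU).prodMap f)
  s_cont := M.s_cont.comp (continuous_id.prodMap hf)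
  s_rat := fun γU hγU γ hγ => M.s_rat γU hγU (f γ) (hΓ γ hγ)
  SK := M.SK
  SK_stable := fun h Φ hΦ => M.SK_stable (f h) Φ hΦ

variable (M : WeilThetaModel GU ΓU G' Γ') (f : G →* G') (hf : Continuous f) (hΓ : ∀ γ ∈ Γ, f γ ∈ Γ')

/-- (Ported verbatim from the HodgeCMPerL package; no docstring in the source.) -/
@[simp] theorem comapRight_W : (M.comapRight f hf hΓ).W = M.W := rfl

/-- (Ported verbatim from the HodgeCMPerL package; no docstring in the source.) -/
@[simp] theorem comapRight_SK : (M.comapRight f hf hΓ).SK = M.SK := rfl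

/-- (Ported verbatim from the HodgeCMPerL package; no docstring in the source.) -/
@[simp] theorem comapRight_s_apply (p : GU × G) : (M.comapRight f hf hΓ).s p = M.s (p.1, f p.2) := rfl

/-- The Weil action of the pull-back is the old one through `f`: `ω'(h)Φ = ω(f h)Φ` in `S(X_A)`. -/
theorem coe_omg_comapRight (h : G) (Φ : (M.comapRight f hf hΓ).SK) :
    ((M.comapRight f hf hΓ).omg h Φ).1 = (M.omg (f h) ⟨Φ.1, Φ.2⟩).1 := rfl

variable [IsTopologicalGroup GU] [IsTopologicalGroup G] [IsTopologicalGroup G']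

/-- The kernels of the pull-back are the old kernels read through `f`: `θ'_Φ(xΓU, yΓ) = θ_Φ(xΓU, f(y)Γ')`. -/
theorem θ_comapRight_mk (Φ : (M.comapRight f hf hΓ).SK) (x : GU) (y : G) :
    (M.comapRight f hf hΓ).θ Φ (QuotientGroup.mk x, QuotientGroup.mk y) =
      M.θ ⟨Φ.1, Φ.2⟩ (QuotientGroup.mk x, QuotientGroup.mk (f y)) := by
  -- `thetaFun Φ p = Θ_Φ(s(p⁻¹))`: the two sides differ by `f(y⁻¹) = (f y)⁻¹` only
  simp only [θ_mk, Prod.inv_mk, comapRight_s_apply, map_inv]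
  rfl

/-- **Weight transfer.**  A weight law `θ_{ω(f h)Φ} = c • θ_Φ` in `M` gives `θ_{ω'(h)Φ} = c • θ_Φ` in the
pull-back. -/
theorem θ_omg_comapRight_of_weight (h : G) (c : ℂ) (Φ : (M.comapRight f hf hΓ).SK)
    (hw : M.θ (M.omg (f h) ⟨Φ.1, Φ.2⟩) = c • M.θ ⟨Φ.1, Φ.2⟩) :
    (M.comapRight f hf hΓ).θ ((M.comapRight f hf hΓ).omg h Φ) = c • (M.comapRight f hf hΓ).θ Φ := by
  ext p
  obtain ⟨ξ, q⟩ := p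
  induction ξ using QuotientGroup.induction_on with
  | H x =>
    induction q using QuotientGroup.induction_on with
    | H y =>
      have hp := congrArg (fun F : C((GU ⧸ ΓU) × (G' ⧸ Γ'), ℂ) => F (QuotientGroup.mk x, QuotientGroup.mk (f y))) hw
      simp only [ContinuousMap.smul_apply] at hp
      rw [ContinuousMap.smul_apply, θ_comapRight_mk, θ_comapRight_mk]
      exact hp

/-- Non-vanishing transfers at the base point: `θ'_Φ(1, 1) = θ_Φ(1, 1)`. -/
theorem θ_comapRight_one (Φ : (M.comapRight f hf hΓ).SK) :
    (M.comapRight f hf hΓ).θ Φ (QuotientGroup.mk 1, QuotientGroup.mk 1) =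
      M.θ ⟨Φ.1, Φ.2⟩ (QuotientGroup.mk 1, QuotientGroup.mk 1) := by
  rw [θ_comapRight_mk, map_one]

end WeilThetaModel

/-! ## §2  The Schrödinger–lattice model over the genuine torus `U(1)_{L/L⁺}(𝔸_{L⁺})` -/

namespace PerL34
namespace ArchAWeil

open ArchA NumberField NumberField.SeesawTorus

section CharIdeles

variable (L : Type) [Field L] [NumberField L]

local notation "L⁺" => maximalRealSubfield L

/-- An automorphic character of `[U(W)]` lifted to `U(W)(𝔸)`: `χ ∘ cl`. -/
def charIdeles (χ : PontryaginDual (relNormOneIdeles L⁺ L ⧸ relNormOneRat L⁺ L)) :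
    relNormOneIdeles L⁺ L →* Circle :=
  χ.toMonoidHom.comp (QuotientGroup.mk' (relNormOneRat L⁺ L))

variable (χ : PontryaginDual (relNormOneIdeles (maximalRealSubfield L) L ⧸ relNormOneRat (maximalRealSubfield L) L))

/-- (Ported verbatim from the HodgeCMPerL package; no docstring in the source.) -/
theorem charIdeles_apply (g : relNormOneIdeles L⁺ L) :
    charIdeles L χ g = χ (QuotientGroup.mk g : relNormOneIdeles L⁺ L ⧸ relNormOneRat L⁺ L) := rfl

/-- (Ported verbatim from the HodgeCMPerL package; no docstring in the source.) -/
theorem continuous_charIdeles : Continuous (charIdeles L χ) :=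
  (map_continuous χ).comp QuotientGroup.continuous_mk

/-- `χ ∘ cl` is trivial on the rational points `U(W)(L⁺)`. -/
theorem charIdeles_of_mem_rat (γ : relNormOneIdeles L⁺ L) (hγ : γ ∈ relNormOneRat L⁺ L) :
    charIdeles L χ γ = 1 := by
  rw [charIdeles_apply, (QuotientGroup.eq_one_iff γ).mpr hγ, map_one]

/-- … so it carries `U(W)(L⁺)` into any subgroup `Γ ≤ S¹` (the hypothesis of `comapRight`). -/
theorem charIdeles_mem_of_mem_rat (Γ : Subgroup Circle) (γ : relNormOneIdeles L⁺ L) (hγ : γ ∈ relNormOneRat L⁺ L) :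
    charIdeles L χ γ ∈ Γ := by
  rw [charIdeles_of_mem_rat L χ γ hγ]
  exact Γ.one_mem

variable [IsCMField L]

/-- On the real-place circles: `(χ ∘ cl)(ι_b(u)) = χ(ι̅_b(u))` (pv11-g5 `realPlaceCircleQuot`). -/
theorem charIdeles_realPlaceCircle (b : InfinitePlace L⁺) (u : Circle) :
    charIdeles L χ (realPlaceCircle L b u) = χ (realPlaceCircleQuot L b u) := rfl

end CharIdeles

section Model

variable (E : Type) [NormedAddCommGroup E] [NormedSpace ℝ E] [FiniteDimensional ℝ E]
  (Λ : Submodule ℤ E) [DiscreteTopology Λ] (m : ℤ) (Γ : Subgroup Circle) (hΓ : ∀ u ∈ Γ, u ^ m = 1)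
variable (L : Type) [Field L] [NumberField L]

local notation "L⁺" => maximalRealSubfield L

variable (χ : PontryaginDual (relNormOneIdeles (maximalRealSubfield L) L ⧸ relNormOneRat (maximalRealSubfield L) L))

/-- **The Schrödinger–lattice model pulled back to the genuine torus** along `χ ∘ cl : U(W)(𝔸) →* S¹`. -/
def genuineSchrodingerModel :
    WeilThetaModel (Multiplicative E) (SchwartzWeil.latticeSubgroup E Λ)
      (relNormOneIdeles L⁺ L) (relNormOneRat L⁺ L) :=
  (SchwartzWeil.schrodingerModel E Λ m Γ hΓ).comapRight (charIdeles L χ) (continuous_charIdeles L χ)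
    (charIdeles_mem_of_mem_rat L χ Γ)

/-- Its index space is all of `S(E)` (pv14-g4's `SK = univ`, unchanged by the pull-back). -/
theorem genuineSchrodingerModel_SK : (genuineSchrodingerModel E Λ m Γ hΓ L χ).SK = Set.univ := rfl

/-- **Non-degenerate**: some theta kernel of the genuine-torus model is non-zero. -/
theorem θ_genuineSchrodinger_ne_zero :
    ∃ Φ : (genuineSchrodingerModel E Λ m Γ hΓ L χ).SK, (genuineSchrodingerModel E Λ m Γ hΓ L χ).θ Φ ≠ 0 := by
  obtain ⟨⟨Φ, hΦS⟩, hΦ⟩ := SchwartzWeil.schrodingerModel_θ_ne_zero E Λ m Γ hΓ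
  refine ⟨⟨Φ, hΦS⟩, fun h0 => hΦ ?_⟩
  have h1 := WeilThetaModel.θ_comapRight_one (SchwartzWeil.schrodingerModel E Λ m Γ hΓ) (charIdeles L χ)
    (continuous_charIdeles L χ) (charIdeles_mem_of_mem_rat L χ Γ) ⟨Φ, hΦS⟩
  have h2 : (genuineSchrodingerModel E Λ m Γ hΓ L χ).θ ⟨Φ, hΦS⟩ (QuotientGroup.mk 1, QuotientGroup.mk 1) = 0 := by
    rw [h0, ContinuousMap.zero_apply]
  exact h1.symm.trans h2

variable [IsCMField L]

/-- **The real-place circles act on every kernel by ONE weight**: if `χ` has real-place exponents `e`, then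
`θ_{ω(ι_b(u))Φ} = u^{e_b m} • θ_Φ` (pv02-g5 `θ_omg_schrodinger` read through `χ ∘ cl`). -/
theorem θ_omg_realPlaceCircle_genuineSchrodinger {e : InfinitePlace L⁺ → ℤ}
    (hχ : ∀ (b : InfinitePlace L⁺) (u : Circle), χ (realPlaceCircleQuot L b u) = u ^ (e b))
    (b : InfinitePlace L⁺) (u : Circle) (Φ : (genuineSchrodingerModel E Λ m Γ hΓ L χ).SK) :
    (genuineSchrodingerModel E Λ m Γ hΓ L χ).θ ((genuineSchrodingerModel E Λ m Γ hΓ L χ).omg (realPlaceCircle L b u) Φ)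
      = ((u : ℂ) ^ (e b * m)) • (genuineSchrodingerModel E Λ m Γ hΓ L χ).θ Φ := by
  refine WeilThetaModel.θ_omg_comapRight_of_weight (SchwartzWeil.schrodingerModel E Λ m Γ hΓ) (charIdeles L χ)
    (continuous_charIdeles L χ) (charIdeles_mem_of_mem_rat L χ Γ) (realPlaceCircle L b u) ((u : ℂ) ^ (e b * m)) Φ ?_
  rw [charIdeles_realPlaceCircle, hχ, θ_omg_schrodinger, Circle.coe_zpow, ← zpow_mul]

/-- **`KernelWeightDecomposition`** for the genuine-torus model and the genuine real-place circles
(one-term decompositions, weight `e_b m`). -/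
theorem kernelWeightDecomposition_genuineSchrodinger {e : InfinitePlace L⁺ → ℤ}
    (hχ : ∀ (b : InfinitePlace L⁺) (u : Circle), χ (realPlaceCircleQuot L b u) = u ^ (e b)) :
    KernelWeightDecomposition (genuineSchrodingerModel E Λ m Γ hΓ L χ) (realPlaceCircle L) := by
  intro b Φ
  refine ⟨1, fun _ => Φ, fun _ => e b * m, ?_, fun _ u => ?_⟩
  · rw [Fin.sum_univ_one]
  · exact θ_omg_realPlaceCircle_genuineSchrodinger E Λ m Γ hΓ L χ hχ b u Φ

/-- Hence (this seat's #3) every kernel orbit span is finite-dimensional … -/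
theorem orbitFinite_genuineSchrodinger {e : InfinitePlace L⁺ → ℤ}
    (hχ : ∀ (b : InfinitePlace L⁺) (u : Circle), χ (realPlaceCircleQuot L b u) = u ^ (e b)) :
    OrbitFinite (genuineSchrodingerModel E Λ m Γ hΓ L χ) (realPlaceCircle L) :=
  orbitFinite_of_kernelWeightDecomposition _ _ (kernelWeightDecomposition_genuineSchrodinger E Λ m Γ hΓ L χ hχ)

/-- … and the `K`-finite index space (#1) is the whole index space. -/
theorem finiteSK_genuineSchrodinger {e : InfinitePlace L⁺ → ℤ}
    (hχ : ∀ (b : InfinitePlace L⁺) (u : Circle), χ (realPlaceCircleQuot L b u) = u ^ (e b)) :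
    (genuineSchrodingerModel E Λ m Γ hΓ L χ).finiteSK (realPlaceCircle L) =
      (genuineSchrodingerModel E Λ m Γ hΓ L χ).SK :=
  finiteSK_eq_SK_of_kernelWeightDecomposition _ _ (kernelWeightDecomposition_genuineSchrodinger E Λ m Γ hΓ L χ hχ)

variable [IsZLattice ℝ Λ] (ι₁ : InfinitePlace (maximalRealSubfield L)) (kJ : InfinitePlace (maximalRealSubfield L) → ℤ)

/-- **N27 = PerL v5 Lemma 4.1(a) for the CONSTRUCTED genuine-torus model, NO hypothesis** (this seat's #2
`N27_genuine_finite` with `OrbitFinite` discharged). -/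
theorem N27_genuineSchrodinger {e : InfinitePlace L⁺ → ℤ}
    (hχ : ∀ (b : InfinitePlace L⁺) (u : Circle), χ (realPlaceCircleQuot L b u) = u ^ (e b)) :
    (lineData (genuineSchrodingerModel E Λ m Γ hΓ L χ) ι₁ (realPlaceCircle L) kJ).N27_statement :=
  N27_genuine_finite L _ ι₁ kJ (orbitFinite_genuineSchrodinger E Λ m Γ hΓ L χ hχ)

/-- **NON-VACUITY OF `N27_genuine`'S BINDER TYPE.**  For every CM field `L` and every exponent vector `e` on the
real places of `L⁺` there is a Weil theta model over the genuine torus `U(1)_{L/L⁺}(𝔸_{L⁺})` (index space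
`S(E)`, first group `E / Λ`) with a non-zero theta kernel, all of whose kernels have real-place weights `e_b m`
under the genuine real-place circles, every kernel orbit span finite-dimensional, and for which pv02's verbatim
N27 holds. -/
theorem exists_genuine_model_N27 (e : InfinitePlace L⁺ → ℤ) :
    ∃ M : WeilThetaModel (Multiplicative E) (SchwartzWeil.latticeSubgroup E Λ)
        (relNormOneIdeles L⁺ L) (relNormOneRat L⁺ L),
      (∃ Φ : M.SK, M.θ Φ ≠ 0) ∧
      (∀ (b : InfinitePlace L⁺) (u : Circle) (Φ : M.SK),
          M.θ (M.omg (realPlaceCircle L b u) Φ) = ((u : ℂ) ^ (e b * m)) • M.θ Φ) ∧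
      OrbitFinite M (realPlaceCircle L) ∧
      (lineData M ι₁ (realPlaceCircle L) kJ).N27_statement := by
  obtain ⟨χ, hχ⟩ := exists_char_forall_realPlaceCircle' (L := L) e
  -- the lattice-stabiliser subgroup of `S¹` plays no role downstairs: take `Γ = ⊥`
  have hbot : ∀ u ∈ (⊥ : Subgroup Circle), u ^ m = 1 := fun u hu => by rw [Subgroup.mem_bot.1 hu, one_zpow]
  exact ⟨genuineSchrodingerModel E Λ m ⊥ hbot L χ, θ_genuineSchrodinger_ne_zero E Λ m ⊥ hbot L χ,
    θ_omg_realPlaceCircle_genuineSchrodinger E Λ m ⊥ hbot L χ hχ, orbitFinite_genuineSchrodinger E Λ m ⊥ hbot L χ hχ,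
    N27_genuineSchrodinger E Λ m ⊥ hbot L χ ι₁ kJ hχ⟩

end Model

end ArchAWeil
end PerL34
end HodgeCM

end
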